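import Mathlib
import HarnessLib
import Summits.Ventures.LatticeQCDFlow.Exactness.SphereFlowLightCone
import Summits.Ventures.LatticeQCDFlow.Exactness.LatticeBoundedDifferences
import Summits.Ventures.LatticeQCDFlow.Exactness.LatticeLocalSumVariance
import Summits.Ventures.LatticeQCDFlow.Exactness.SphereFlowLiouvilleMeasure

/-!
# The law of the flowed uniform configuration has no correlations beyond the light cone: `|Cov_π̄(A∘Φ, B∘Φ)| ≤ 2τ_m·(ℓ_A b + a ℓ_B)`, `τ_m = 2e^{K|t|}(K|t|)^{m+1}/(m+1)!`, for every sphere flow whose generator has strict read sets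

HONEST FRAMING: exact (Metropolis-corrected) sampling algorithms for lattice gauge theory;
figures of merit are autocorrelation/cost numbers at stated couplings and volumes; no
continuum-physics claim.

Venture `LatticeQCDFlow` (cell pub-lqcd), topic `Exactness`; FANOUT row 7 (`s0-cpn-null`: the
S0-D1 rung — 2D CP⁹, Lüscher's LO trivializing map inside HMC, Engel–Schaefer 2011).  NEW WORK of
the cell over this leg's `Exactness/SphereFlowLightCone.lean` (THEOREM L for the sphere flow in ball
form), `Exactness/LatticeBoundedDifferences.lean` (a probability space is nonempty) and GEN-10's
`Exactness/LatticeLocalSumVariance.lean` (`integral_centered_mul_eq_zero_of_disjoint`: functions of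
disjoint coordinate blocks are uncorrelated under the product law — the Literature lemma
`Probability/LatticeModels/ProductMeasureTools.integral_mul_eq_of_dependsOn_disjoint`, reused) and
GEN-15's `Exactness/SphereFlowLiouvilleMeasure.lean` (`Ω`, `π̄`); nothing is cited as a fact.  Printed counterpart, NAMED ONLY: M. Lüscher, Commun. Math. Phys. 293
(2010) 899, §4.5 (flow-defined maps are local); the venture statement's T9
(`StatementLocality.lean`, `TrivializingMaps/TruncatedFlowAcceptanceFootprint.lean`) whose first
half — the model law decorrelates beyond the cone — is what THIS FILE proves on the sphere side for
every generator with strict read sets; the Engel–Schaefer leading-order instance is the sequel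
`Exactness/SphereFlowDecorrelation.lean`.

## Setting

`π̄ = ⊗_Λ σ̄` on `Ω = S(E)^Λ`; `Φ = Φ_{t₀→t₁}` a sphere flow (`sphereTDFlow hG T t₀ t₁`) whose
generator has read sets `N i` and sup-modulus `K ≥ 0` between `t₀` and `t₁`; observables `A`, `B` on
configurations, continuous, bounded by `a`, `b` on `Ω̃`, with FOOTPRINTS `S_A`, `S_B ⊆ Λ` and
sup-Lipschitz moduli `ℓ_A`, `ℓ_B` there; the radius-`m` neighbourhoods `⋃_{i∈S_A} nball N m i` and
`⋃_{j∈S_B} nball N m j` are DISJOINT; `τ_m = 2·e^{K|t₁−t₀|}(K|t₁−t₀|)^{m+1}/(m+1)!`.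

## Content

* §1 the glued configuration `(nball N m i).piecewise x e`: `continuous_glue`, `norm_glue_eq_one`,
  `glue_eq_of_agree`, **`norm_sphereTDFlow_sub_glued_le`** (the flow at site `i` differs from the flow
  of the glued configuration at site `i` by at most `τ_m`).
* §2 **`abs_cov_le_of_approx`** (covariance algebra), **`abs_cov_comp_sphereTDFlow_le`** —
  DECORRELATION BEYOND THE CONE: `|Cov_π̄(A∘Φ, B∘Φ)| ≤ 2τ_m·(ℓ_A·b + a·ℓ_B)` whenever the radius-`m`
  read-set neighbourhoods of the footprints are disjoint (the approximants `A∘Ψ`, `B∘Ψ` depend on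
  disjoint coordinate blocks, hence are uncorrelated under `π̄`; each is `ℓτ_m`-close to the flowed
  observable), in every volume.

NOT CLAIMED: lower bounds on the target's correlations; the acceptance consequence (sequel
`SphereLOFlowAcceptanceFootprint`); the one-step map of the rung; numbers.
-/

noncomputable section

namespace Summit.Ventures.LatticeQCDFlow.Exactness

open Function Set Metric MeasureTheory NormedSpace InnerProductSpace
open scoped RealInnerProductSpace Topology Nat

variable {Λ : Type*} {E : Type*} [NormedAddCommGroup E] [InnerProductSpace ℝ E]
  [FiniteDimensional ℝ E] [Fintype Λ] [DecidableEq Λ] {G : ℝ → (Λ → E) → ℝ} {T : ℝ}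

/-! ## §1 The glued configuration and the strictly local approximant -/

section Glue

omit [InnerProductSpace ℝ E] [FiniteDimensional ℝ E] [Fintype Λ] [DecidableEq Λ] in
/-- Gluing is continuous in the configuration. -/
theorem continuous_glue (A : Set Λ) [DecidablePred (· ∈ A)] (e : Λ → E) :
    Continuous fun x : Λ → E => A.piecewise x e := by
  refine continuous_pi fun j => ?_
  by_cases hj : j ∈ A
  · simp only [Set.piecewise_eq_of_mem _ _ _ hj]; exact continuous_apply j
  · simp only [Set.piecewise_eq_of_notMem _ _ _ hj]; exact continuous_const

omit [InnerProductSpace ℝ E] [FiniteDimensional ℝ E] [Fintype Λ] [DecidableEq Λ] in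
/-- Gluing two unit configurations gives a unit configuration. -/
theorem norm_glue_eq_one (A : Set Λ) [DecidablePred (· ∈ A)] {x e : Λ → E} (hx : ∀ n, ‖x n‖ = 1)
    (he : ∀ n, ‖e n‖ = 1) (n : Λ) : ‖A.piecewise x e n‖ = 1 := by
  by_cases hn : n ∈ A
  · rw [Set.piecewise_eq_of_mem _ _ _ hn]; exact hx n
  · rw [Set.piecewise_eq_of_notMem _ _ _ hn]; exact he n

omit [NormedAddCommGroup E] [InnerProductSpace ℝ E] [FiniteDimensional ℝ E] [Fintype Λ]
  [DecidableEq Λ] in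
/-- Configurations agreeing on `A` glue to the same configuration. -/
theorem glue_eq_of_agree (A : Set Λ) [DecidablePred (· ∈ A)] {x x' : Λ → E} (e : Λ → E)
    (h : ∀ j ∈ A, x j = x' j) : A.piecewise x e = A.piecewise x' e := by
  funext j
  by_cases hj : j ∈ A
  · rw [Set.piecewise_eq_of_mem _ _ _ hj, Set.piecewise_eq_of_mem _ _ _ hj, h j hj]
  · rw [Set.piecewise_eq_of_notMem _ _ _ hj, Set.piecewise_eq_of_notMem _ _ _ hj]

/-- **The flow at site `i` is `τ_m`-close to the flow of the configuration glued outside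
`nball N m i`** (the light cone in ball form). -/
theorem norm_sphereTDFlow_sub_glued_le (hG : ContDiff ℝ 2 fun q : ℝ × (Λ → E) => G q.1 q.2)
    (N : Λ → Set Λ) {K : ℝ} (hK : 0 ≤ K) {t₀ t₁ : ℝ}
    (hmod : ∀ t ∈ uIcc t₀ t₁, ∀ x y : Λ → E, (∀ n, ‖x n‖ = 1) → (∀ n, ‖y n‖ = 1) →
      ∀ (i : Λ) (M : ℝ), 0 ≤ M → (∀ j ∈ N i, ‖x j - y j‖ ≤ M) →
        ‖siteGrad i (G t) x - siteGrad i (G t) y‖ ≤ K * M)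
    (m : ℕ) {x e : Λ → E} (hx : ∀ n, ‖x n‖ = 1) (he : ∀ n, ‖e n‖ = 1) (i : Λ)
    [DecidablePred (· ∈ nball N m i)] :
    ‖sphereTDFlow hG T t₀ t₁ x i - sphereTDFlow hG T t₀ t₁ ((nball N m i).piecewise x e) i‖ ≤
      2 * Real.exp (K * |t₁ - t₀|) * (K * |t₁ - t₀|) ^ (m + 1) / ((m + 1)! : ℝ) :=
  norm_sphereTDFlow_sub_le_of_eqOn_nball hG N hK hmod hx (norm_glue_eq_one _ hx he) i m
    (fun _ hj => (Set.piecewise_eq_of_mem _ _ _ hj).symm)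

end Glue

/-! ## §2 Decorrelation beyond the cone, every generator with strict read sets -/

section Decorrelation

variable [MeasurableSpace E] [BorelSpace E] [Nontrivial E]

omit [InnerProductSpace ℝ E] [FiniteDimensional ℝ E] [Fintype Λ] [DecidableEq Λ] [MeasurableSpace E]
  [BorelSpace E] [Nontrivial E] in
/-- Covariance algebra: if `X'`, `Y'` are uncorrelated, `|X − X'| ≤ δ_A`, `|Y − Y'| ≤ δ_B`,
`|Y| ≤ b`, `|X'| ≤ a` pointwise, then `|Cov(X, Y)| ≤ 2(δ_A·b + a·δ_B)` (probability measure,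
everything integrable). -/
theorem abs_cov_le_of_approx {Ω' : Type*} [MeasurableSpace Ω'] {μ : Measure Ω'} [IsProbabilityMeasure μ]
    {X X' Y Y' : Ω' → ℝ} (hX : Integrable X μ) (hX' : Integrable X' μ) (hY : Integrable Y μ)
    (hY' : Integrable Y' μ) (hXY : Integrable (fun ω => X ω * Y ω) μ)
    (hX'Y' : Integrable (fun ω => X' ω * Y' ω) μ)
    (hcov : ∫ ω, X' ω * Y' ω ∂μ = (∫ ω, X' ω ∂μ) * ∫ ω, Y' ω ∂μ)
    {δA δB a b : ℝ} (hdA : ∀ ω, |X ω - X' ω| ≤ δA) (hdB : ∀ ω, |Y ω - Y' ω| ≤ δB)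
    (hb : ∀ ω, |Y ω| ≤ b) (ha : ∀ ω, |X' ω| ≤ a) :
    |∫ ω, X ω * Y ω ∂μ - (∫ ω, X ω ∂μ) * ∫ ω, Y ω ∂μ| ≤ 2 * (δA * b + a * δB) := by
  -- pointwise: `|XY − X'Y'| ≤ δA·b + a·δB`
  have hpt : ∀ ω, |X ω * Y ω - X' ω * Y' ω| ≤ δA * b + a * δB := by
    intro ω
    have e : X ω * Y ω - X' ω * Y' ω = (X ω - X' ω) * Y ω + X' ω * (Y ω - Y' ω) := by ring
    rw [e]
    refine (abs_add_le _ _).trans ?_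
    rw [abs_mul, abs_mul]
    exact add_le_add (mul_le_mul (hdA ω) (hb ω) (abs_nonneg _) (le_trans (abs_nonneg _) (hdA ω)))
      (mul_le_mul (ha ω) (hdB ω) (abs_nonneg _) (le_trans (abs_nonneg _) (ha ω)))
  -- integrated: `|∫XY − ∫X'Y'| ≤ δA·b + a·δB`
  have h1 : |∫ ω, X ω * Y ω ∂μ - ∫ ω, X' ω * Y' ω ∂μ| ≤ δA * b + a * δB := by
    rw [← integral_sub hXY hX'Y']
    refine (abs_integral_le_integral_abs).trans ?_
    have h := integral_mono (hXY.sub hX'Y').abs (integrable_const (δA * b + a * δB)) hpt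
    simp only [integral_const, smul_eq_mul, probReal_univ, one_mul] at h
    exact h
  -- means: `|∫X − ∫X'| ≤ δA`, `|∫Y − ∫Y'| ≤ δB`, `|∫Y| ≤ b`, `|∫X'| ≤ a`
  have hmean : ∀ {U V : Ω' → ℝ} {δ : ℝ}, Integrable U μ → Integrable V μ → (∀ ω, |U ω - V ω| ≤ δ) →
      |∫ ω, U ω ∂μ - ∫ ω, V ω ∂μ| ≤ δ := by
    intro U V δ hU hV hUV
    rw [← integral_sub hU hV]
    refine (abs_integral_le_integral_abs).trans ?_
    have h := integral_mono (hU.sub hV).abs (integrable_const δ) hUV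
    simp only [integral_const, smul_eq_mul, probReal_univ, one_mul] at h
    exact h
  have hbnd : ∀ {U : Ω' → ℝ} {r : ℝ}, Integrable U μ → (∀ ω, |U ω| ≤ r) → |∫ ω, U ω ∂μ| ≤ r := by
    intro U r hU hUr
    refine (abs_integral_le_integral_abs).trans ?_
    have h := integral_mono hU.abs (integrable_const r) hUr
    simp only [integral_const, smul_eq_mul, probReal_univ, one_mul] at h
    exact h
  have h2 : |(∫ ω, X ω ∂μ) * (∫ ω, Y ω ∂μ) - (∫ ω, X' ω ∂μ) * ∫ ω, Y' ω ∂μ| ≤ δA * b + a * δB := by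
    have e : (∫ ω, X ω ∂μ) * (∫ ω, Y ω ∂μ) - (∫ ω, X' ω ∂μ) * (∫ ω, Y' ω ∂μ) =
        ((∫ ω, X ω ∂μ) - ∫ ω, X' ω ∂μ) * (∫ ω, Y ω ∂μ) +
          (∫ ω, X' ω ∂μ) * ((∫ ω, Y ω ∂μ) - ∫ ω, Y' ω ∂μ) := by ring
    rw [e]
    refine (abs_add_le _ _).trans ?_
    rw [abs_mul, abs_mul]
    have hA := hmean hX hX' hdA
    have hB := hmean hY hY' hdB
    exact add_le_add (mul_le_mul hA (hbnd hY hb) (abs_nonneg _) (le_trans (abs_nonneg _) hA))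
      (mul_le_mul (hbnd hX' ha) hB (abs_nonneg _) (le_trans (abs_nonneg _) (hbnd hX' ha)))
  -- combine with `Cov(X', Y') = 0`
  have e : ∫ ω, X ω * Y ω ∂μ - (∫ ω, X ω ∂μ) * ∫ ω, Y ω ∂μ =
      (∫ ω, X ω * Y ω ∂μ - ∫ ω, X' ω * Y' ω ∂μ) -
        ((∫ ω, X ω ∂μ) * (∫ ω, Y ω ∂μ) - (∫ ω, X' ω ∂μ) * ∫ ω, Y' ω ∂μ) := by
    rw [hcov]; ring
  rw [e]
  refine (abs_sub _ _).trans ?_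
  linarith

/-- **DECORRELATION BEYOND THE LIGHT CONE.**  For a sphere flow `Φ = Φ_{t₀→t₁}` whose generator has
read sets `N` and sup-modulus `K ≥ 0`, continuous observables `A`, `B` bounded by `a`, `b` on `Ω̃`
with footprints `S_A`, `S_B` and sup-Lipschitz moduli `ℓ_A`, `ℓ_B` there, and a radius `m` such that
`⋃_{i∈S_A} nball N m i` and `⋃_{j∈S_B} nball N m j` are disjoint:
`|Cov_π̄(A∘Φ, B∘Φ)| ≤ 2τ_m·(ℓ_A·b + a·ℓ_B)`, `τ_m = 2e^{K|t₁−t₀|}(K|t₁−t₀|)^{m+1}/(m+1)!` — THE LAW OF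
THE FLOWED UNIFORM CONFIGURATION HAS NO CORRELATIONS BEYOND THE CONE, in every volume. -/
theorem abs_cov_comp_sphereTDFlow_le (hG : ContDiff ℝ 2 fun q : ℝ × (Λ → E) => G q.1 q.2)
    (N : Λ → Set Λ) {K : ℝ} (hK : 0 ≤ K) {t₀ t₁ : ℝ}
    (hmod : ∀ t ∈ uIcc t₀ t₁, ∀ x y : Λ → E, (∀ n, ‖x n‖ = 1) → (∀ n, ‖y n‖ = 1) →
      ∀ (i : Λ) (M : ℝ), 0 ≤ M → (∀ j ∈ N i, ‖x j - y j‖ ≤ M) →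
        ‖siteGrad i (G t) x - siteGrad i (G t) y‖ ≤ K * M)
    (m : ℕ) {A B : (Λ → E) → ℝ} (hAc : Continuous A) (hBc : Continuous B) {SA SB : Set Λ}
    {a b ℓA ℓB : ℝ} (hAa : ∀ x : Λ → E, (∀ n, ‖x n‖ = 1) → |A x| ≤ a)
    (hBb : ∀ x : Λ → E, (∀ n, ‖x n‖ = 1) → |B x| ≤ b)
    (hAℓ : ∀ x y : Λ → E, (∀ n, ‖x n‖ = 1) → (∀ n, ‖y n‖ = 1) → ∀ η : ℝ,
      (∀ i ∈ SA, ‖x i - y i‖ ≤ η) → |A x - A y| ≤ ℓA * η)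
    (hBℓ : ∀ x y : Λ → E, (∀ n, ‖x n‖ = 1) → (∀ n, ‖y n‖ = 1) → ∀ η : ℝ,
      (∀ i ∈ SB, ‖x i - y i‖ ≤ η) → |B x - B y| ≤ ℓB * η)
    (hsep : Disjoint (⋃ i ∈ SA, nball N m i) (⋃ j ∈ SB, nball N m j)) :
    |∫ ω, A (sphereTDFlow hG T t₀ t₁ (fun n => ((ω : Λ → sphere (0 : E) 1) n : E))) *
          B (sphereTDFlow hG T t₀ t₁ (fun n => (ω n : E)))
          ∂Measure.pi (fun _ : Λ => uniformSphere (volume : Measure E)) -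
        (∫ ω, A (sphereTDFlow hG T t₀ t₁ (fun n => ((ω : Λ → sphere (0 : E) 1) n : E)))
            ∂Measure.pi (fun _ : Λ => uniformSphere (volume : Measure E))) *
          ∫ ω, B (sphereTDFlow hG T t₀ t₁ (fun n => ((ω : Λ → sphere (0 : E) 1) n : E)))
            ∂Measure.pi (fun _ : Λ => uniformSphere (volume : Measure E))| ≤
      2 * (2 * Real.exp (K * |t₁ - t₀|) * (K * |t₁ - t₀|) ^ (m + 1) / ((m + 1)! : ℝ)) *
        (ℓA * b + a * ℓB) := by
  classical
  set μ : Measure (Λ → sphere (0 : E) 1) := Measure.pi (fun _ : Λ => uniformSphere (volume : Measure E))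
    with hμ
  haveI : Nonempty (Λ → sphere (0 : E) 1) := nonempty_of_isProbabilityMeasure μ
  set τ : ℝ := 2 * Real.exp (K * |t₁ - t₀|) * (K * |t₁ - t₀|) ^ (m + 1) / ((m + 1)! : ℝ) with hτ
  -- reference configuration and the glued approximants
  set ω₀ : Λ → sphere (0 : E) 1 := Classical.arbitrary _ with hω₀
  set e : Λ → E := fun n => (ω₀ n : E) with hedef
  have he : ∀ n, ‖e n‖ = 1 := fun n => norm_sphereConfig_eq_one ω₀ n
  set Φ : (Λ → E) → (Λ → E) := sphereTDFlow hG T t₀ t₁ with hΦ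
  set Ψ : (Λ → E) → (Λ → E) := fun x i => Φ ((nball N m i).piecewise x e) i with hΨ
  set X : (Λ → sphere (0 : E) 1) → ℝ := fun ω => A (Φ (fun n => (ω n : E))) with hX
  set Y : (Λ → sphere (0 : E) 1) → ℝ := fun ω => B (Φ (fun n => (ω n : E))) with hY
  set X' : (Λ → sphere (0 : E) 1) → ℝ := fun ω => A (Ψ (fun n => (ω n : E))) with hX'
  set Y' : (Λ → sphere (0 : E) 1) → ℝ := fun ω => B (Ψ (fun n => (ω n : E))) with hY'
  -- continuity
  have hΦc : Continuous Φ := (contDiff_sphereTDFlow_apply hG t₀ t₁ (T := T)).continuous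
  have hΨc : Continuous Ψ := by
    refine continuous_pi fun i => ?_
    exact (continuous_apply i).comp (hΦc.comp (continuous_glue (nball N m i) e))
  have hXc : Continuous X := hAc.comp (hΦc.comp continuous_sphereConfig)
  have hYc : Continuous Y := hBc.comp (hΦc.comp continuous_sphereConfig)
  have hX'c : Continuous X' := hAc.comp (hΨc.comp continuous_sphereConfig)
  have hY'c : Continuous Y' := hBc.comp (hΨc.comp continuous_sphereConfig)
  -- unit configurations everywhere
  have hω1 : ∀ ω : Λ → sphere (0 : E) 1, ∀ n, ‖(fun n => (ω n : E)) n‖ = 1 :=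
    fun ω n => norm_sphereConfig_eq_one ω n
  have hΦ1 : ∀ ω : Λ → sphere (0 : E) 1, ∀ n, ‖Φ (fun n => (ω n : E)) n‖ = 1 :=
    fun ω n => norm_sphereTDFlow_eq_one hG t₀ (hω1 ω) t₁ n
  have hΨ1 : ∀ ω : Λ → sphere (0 : E) 1, ∀ n, ‖Ψ (fun n => (ω n : E)) n‖ = 1 :=
    fun ω n => norm_sphereTDFlow_eq_one hG t₀ (norm_glue_eq_one _ (hω1 ω) he) t₁ n
  -- the cone: `‖Φ(x)_i − Ψ(x)_i‖ ≤ τ` at every site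
  have hcone : ∀ ω : Λ → sphere (0 : E) 1, ∀ i, ‖Φ (fun n => (ω n : E)) i - Ψ (fun n => (ω n : E)) i‖ ≤ τ :=
    fun ω i => norm_sphereTDFlow_sub_glued_le hG N hK hmod m (hω1 ω) he i
  have hdA : ∀ ω, |X ω - X' ω| ≤ ℓA * τ :=
    fun ω => hAℓ _ _ (hΦ1 ω) (hΨ1 ω) τ fun i _ => hcone ω i
  have hdB : ∀ ω, |Y ω - Y' ω| ≤ ℓB * τ :=
    fun ω => hBℓ _ _ (hΦ1 ω) (hΨ1 ω) τ fun i _ => hcone ω i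
  -- the approximants depend on disjoint coordinate blocks
  have hdepX : DependsOn X' (⋃ i ∈ SA, nball N m i) := by
    intro ω ω' hagree
    simp only [hX']
    have hη : ∀ i ∈ SA, ‖Ψ (fun n => (ω n : E)) i - Ψ (fun n => (ω' n : E)) i‖ ≤ 0 := by
      intro i hi
      have hcfg : (nball N m i).piecewise (fun n => (ω n : E)) e =
          (nball N m i).piecewise (fun n => (ω' n : E)) e :=
        glue_eq_of_agree _ e fun j hj => by
          have := hagree j (Set.mem_biUnion hi hj); simp only at this; rw [this]
      simp only [hΨ, hcfg, sub_self, norm_zero, le_refl]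
    have h := hAℓ _ _ (hΨ1 ω) (hΨ1 ω') 0 hη
    rw [mul_zero] at h
    exact eq_of_abs_sub_nonpos h
  have hdepY : DependsOn Y' (⋃ j ∈ SB, nball N m j) := by
    intro ω ω' hagree
    simp only [hY']
    have hη : ∀ i ∈ SB, ‖Ψ (fun n => (ω n : E)) i - Ψ (fun n => (ω' n : E)) i‖ ≤ 0 := by
      intro i hi
      have hcfg : (nball N m i).piecewise (fun n => (ω n : E)) e =
          (nball N m i).piecewise (fun n => (ω' n : E)) e :=
        glue_eq_of_agree _ e fun j hj => by
          have := hagree j (Set.mem_biUnion hi hj); simp only at this; rw [this]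
      simp only [hΨ, hcfg, sub_self, norm_zero, le_refl]
    have h := hBℓ _ _ (hΨ1 ω) (hΨ1 ω') 0 hη
    rw [mul_zero] at h
    exact eq_of_abs_sub_nonpos h
  -- zero covariance of the approximants
  have hcov0 := integral_centered_mul_eq_zero_of_disjoint (uniformSphere (volume : Measure E)) hsep
    hX'c hY'c hdepX hdepY
  have hiX' : Integrable X' μ := integrable_pi_of_continuous _ hX'c
  have hiY' : Integrable Y' μ := integrable_pi_of_continuous _ hY'c
  have hcov : ∫ ω, X' ω * Y' ω ∂μ = (∫ ω, X' ω ∂μ) * ∫ ω, Y' ω ∂μ := by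
    have hprod : Integrable (fun ω => X' ω * Y' ω) μ := integrable_pi_of_continuous _ (hX'c.mul hY'c)
    have e : ∀ ω, (X' ω - ∫ ω', X' ω' ∂μ) * (Y' ω - ∫ ω', Y' ω' ∂μ) =
        X' ω * Y' ω - (∫ ω', Y' ω' ∂μ) * X' ω - (∫ ω', X' ω' ∂μ) * Y' ω +
          (∫ ω', X' ω' ∂μ) * ∫ ω', Y' ω' ∂μ := by intro ω; ring
    rw [← hμ] at hcov0
    simp_rw [e] at hcov0
    have hi1 : Integrable (fun ω => (∫ ω', Y' ω' ∂μ) * X' ω) μ := hiX'.const_mul _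
    have hi2 : Integrable (fun ω => (∫ ω', X' ω' ∂μ) * Y' ω) μ := hiY'.const_mul _
    have hi3 : Integrable (fun ω => X' ω * Y' ω - (∫ ω', Y' ω' ∂μ) * X' ω) μ := hprod.sub hi1
    have hi4 : Integrable (fun ω => X' ω * Y' ω - (∫ ω', Y' ω' ∂μ) * X' ω -
        (∫ ω', X' ω' ∂μ) * Y' ω) μ := hi3.sub hi2
    rw [integral_add hi4 (integrable_const _), integral_sub hi3 hi2, integral_sub hprod hi1,
      integral_const_mul, integral_const_mul, integral_const, smul_eq_mul, probReal_univ,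
      one_mul] at hcov0
    linarith
  -- conclude
  have h := abs_cov_le_of_approx (μ := μ) (integrable_pi_of_continuous _ hXc) hiX'
    (integrable_pi_of_continuous _ hYc) hiY' (integrable_pi_of_continuous _ (hXc.mul hYc))
    (integrable_pi_of_continuous _ (hX'c.mul hY'c)) hcov hdA hdB (fun ω => hBb _ (hΦ1 ω))
    (fun ω => hAa _ (hΨ1 ω))
  calc _ ≤ 2 * (ℓA * τ * b + a * (ℓB * τ)) := h
    _ = 2 * τ * (ℓA * b + a * ℓB) := by ring

end Decorrelation

end Summit.Ventures.LatticeQCDFlow.Exactness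

end
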